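import Mathlib
import HarnessLib
import Literature.Analysis.FluidPDE.PressurePoisson
import Summits.NavierStokesRegularity.NavierStokesRegularity.Theorems.UnthreadedRigidityDoorUnthreadedRigidityThreadingJets
import Summits.NavierStokesRegularity.NavierStokesRegularity.Theorems.UnthreadedRigidityDoorUnthreadedRigidityThreadingJetsDefs

/-!
# Route `UnthreadedRigidityDoor`, item `UnthreadedRigidity` (W2, stmt-NavierStokesRegularity-27585) — THREADING JETS, SLICE REDUCTIONS:
# the bridges PH / LEMMA SEP (LINE g10-2 «PROFILE HORN») and V (LINE g11-1 «VIRIAL HORN») follow from their SLICE forms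
# (director-ns dss_142: bridge V = `OrderTwoSliceLaw` ∘ this implication; split of record crc-p1 g8 = M, crc-p2 g8 = L)

Seat ns-crc-p1 g8, `--supports stmt-NavierStokesRegularity-27585 --as helper`.  Inputs BY NAME (import, never restate): the jet
dictionary `…ThreadingJets` (this seat, file 1/3, p704318), the formal jets and slice Props `…ThreadingJetsDefs` (file 2/3, p704398),
the PROFILE/VIRIAL HORN Defs of g7 (p689891, p695782).

CONTENT.
§1 The pressure Poisson equation UP TO THE BOUNDARY of the time set (`div ∂ₜu = 0` one-sidedly; the tree's
   `laplacian_pressure_eq_of_isClassicalNSSolutionOn` is the interior-time case): `laplacian_pressure_eq`, `laplacian_pressure_eq_Ico`.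
§2 Open time windows: the two-sided jets `deriv_threadingFlux_of_isOpen`, `iteratedDeriv_two_threadingFlux_of_isOpen` (the shape of the
   window bridges PH-W / V-W at interior times, for a classical solution on an open `S`).
§3 The dictionary in the vocabulary of the Defs file: `derivWithin_threadingFlux_Ici_eq_fluxJetOne`,
   `iteratedDerivWithin_two_threadingFlux_Ici_eq_fluxJetTwo`.
§4 THE REDUCTIONS (each bridge's hypotheses at `t₀` supply the slice statement's hypotheses for free — smoothness and incompressibility
   of `u(t₀)`, smoothness of `p(t₀)`, Poisson, decay — and the dictionary turns the one-sided jets into the formal ones):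
   ★ `orderTwoVirialIdentity_of_sliceLaw : OrderTwoSliceLaw → VirialHorn.OrderTwoVirialIdentity` (bridge V is L-only),
   ★ `hornIdentityTwo_of_slice : HornSliceIdentityTwo → ProfileHorn.HornIdentityTwo` (bridge PH is L-only),
   ★ `separableOrderOneSilence_of_slice : SeparableSliceOrderOneSilence → ProfileHorn.SeparableOrderOneSilence` (LEMMA SEP is L-only).
   (The rungs re-based on the slice statements through g7's compositions — `OrderTwoSliceLaw → AngularLemma → SeparableOrderTwoRigidityL`,
   `OrderTwoSliceLaw → SeparableShellOrderTwoRigidity` — are one-liners filed separately in `…ThreadingJetsRungs.lean`, because the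
   composition modules import the route file (theses cone).)

HONEST FRAMING: bookkeeping (M-parts and re-basing) of two RUNG lines on the wall item; the slice statements themselves — the (F1)/(F2)
algebra and the (F3) virial lemma for explicit fields — are NOT proved here (crc-p2 g8's hand per dss_142); nothing here bears on
`UnthreadedRigidity` (27585), the door Target, W2 or Navier–Stokes regularity; no summit statement is proved.  MODEL/rung work.
[folklore]

References: A. J. Majda, A. L. Bertozzi (CUP 2002) §1.1, Prop. 2.4; T. Tao (2011/2013), (8) (pressure Poisson equation).
-/

noncomputable section

-- the summit and its single sub-problem share the name (CONVENTIONS §1), as in every Theorems file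
set_option linter.dupNamespace false

namespace Summit.NavierStokesRegularity.NavierStokesRegularity.Theorems.UnthreadedRigidity.ThreadingJets

open Set Function Filter Topology
open scoped RealInnerProductSpace InnerProductSpace ContDiff Laplacian
open Literature.Analysis.FluidPDE
open Summit.NavierStokesRegularity.NavierStokesRegularity.Theorems.UnthreadedRigidity.ProfileHorn
  (E3 threadingFlux IsQuadForm HornAdmissible sepShell vortAmp discrCubic hornBracket HornIdentityTwo SeparableOrderOneSilence)
open Summit.NavierStokesRegularity.NavierStokesRegularity.Theorems.UnthreadedRigidity.VirialHorn
  (IsSolidHarmonic VirialAdmissible sepShellL virialMoment angForm OrderTwoVirialIdentity)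

variable {S : Set ℝ}

/-! ### 1. The pressure Poisson equation up to the boundary of the time set -/

section Poisson

variable {u : ℝ → E3 → E3} {p : ℝ → E3 → ℝ}

/-- **`div ∂ₜu = 0` up to the boundary of the time set** for a jointly smooth velocity with divergence-free
slices (`div ∂ₜu = ∂ₜ div u`, exchange of `∂ₜ` and `D`). [folklore] -/
theorem divergence_timeDerivWithin_eq_zero {u : ℝ → E3 → E3} (hu : IsSmoothSpaceTimeOn S u)
    (hS : UniqueDiffOn ℝ S) (hcl : S ⊆ closure (interior S))
    (hdiv : ∀ s ∈ S, VectorCalculus.IsDivFree (u s)) {t : ℝ} (ht : t ∈ S) (x : E3) :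
    VectorCalculus.divergence (timeDerivWithin S u t) x = 0 := by
  set b := stdOrthonormalBasis ℝ E3
  have h1 : ∀ i, IsSmoothSpaceTimeOn S (fun s y => fderiv ℝ (u s) y (b i)) := fun i =>
    hu.fderiv_slice_apply hS (b i)
  -- each term `⟪bᵢ, D(∂ₜu)(x) bᵢ⟫` is the time derivative of `⟪bᵢ, D(u ·)(x) bᵢ⟫`
  have hj : ∀ i, HasDerivWithinAt (fun s => ⟪b i, fderiv ℝ (u s) x (b i)⟫)
      ⟪b i, fderiv ℝ (timeDerivWithin S u t) x (b i)⟫ S t := by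
    intro i
    have h2 := (hasDerivWithinAt_const t S (b i)).inner ℝ
      ((h1 i).hasDerivWithinAt_timeDerivWithin hS ht x)
    rw [hu.timeDerivWithin_fderiv_slice_apply hS hcl ht x (b i)] at h2
    simpa using h2
  have hsum : HasDerivWithinAt (fun s => ∑ i, ⟪b i, fderiv ℝ (u s) x (b i)⟫)
      (∑ i, ⟪b i, fderiv ℝ (timeDerivWithin S u t) x (b i)⟫) S t :=
    HasDerivWithinAt.fun_sum fun i _ => hj i
  have hzero : ∀ s ∈ S, ∑ i, ⟪b i, fderiv ℝ (u s) x (b i)⟫ = 0 := fun s hs => by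
    rw [← divergence_eq_sum_inner_fderiv b (u s) x]
    exact hdiv s hs x
  have h0 : HasDerivWithinAt (fun _ : ℝ => (0 : ℝ))
      (∑ i, ⟪b i, fderiv ℝ (timeDerivWithin S u t) x (b i)⟫) S t :=
    hsum.congr_of_mem (fun s hs => (hzero s hs).symm) ht
  rw [divergence_eq_sum_inner_fderiv b]
  have := h0.derivWithin (hS t ht)
  simp only [derivWithin_fun_const, Pi.zero_apply] at this
  exact this.symm

/-- **The pressure Poisson equation up to the boundary of the time set** (Tao 2011, (8), at EVERY `t ∈ S`,
`S ⊆ closure (interior S)` of unique differentiability — the tree's `laplacian_pressure_eq_of_isClassicalNSSolutionOn` is the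
interior-time case): `Δp(t) = −div((u·∇)u)(t)` (divergence of the momentum equation, `div ∂ₜu = 0` up to the boundary,
`div Δu = 0`, `div ∇p = Δp`). [folklore] -/
theorem laplacian_pressure_eq (h : IsClassicalNSSolutionOn S 1 0 u p) (hS : UniqueDiffOn ℝ S)
    (hcl : S ⊆ closure (interior S)) {t : ℝ} (ht : t ∈ S) (x : E3) :
    (Δ (p t)) x = -VectorCalculus.divergence (convect (u t) (u t)) x := by
  have hu : ContDiff ℝ ∞ (u t) := h.contDiff_velocity ht
  have hp : ContDiff ℝ ∞ (p t) := h.contDiff_pressure ht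
  have hΔd : Differentiable ℝ (Δ (u t)) := differentiable_laplacian (hu.of_le (by norm_cast))
  have hcd : Differentiable ℝ (convect (u t) (u t)) := differentiable_convect hu hu
  have hgrad : gradient (p t) = fun y => (Δ (u t)) y - convect (u t) (u t) y - timeDerivWithin S u t y := by
    funext y
    have e : timeDerivWithin S u t y = (Δ (u t)) y - convect (u t) (u t) y - gradient (p t) y := by
      rw [timeDerivWithin_velocity_eq h ht]
    rw [e]
    exact (sub_sub_cancel _ _).symm
  have hUd : Differentiable ℝ (timeDerivWithin S u t) :=
    ((h.smooth_velocity.timeDerivWithin hS).contDiff_slice ht).differentiable (by simp)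
  have hdivU : VectorCalculus.divergence (timeDerivWithin S u t) x = 0 :=
    divergence_timeDerivWithin_eq_zero h.smooth_velocity hS hcl h.divFree ht x
  have hdivΔ : VectorCalculus.divergence (Δ (u t)) x = 0 :=
    divergence_laplacian_eq_zero (hu.of_le (by norm_cast)) (h.divFree t ht) x
  rw [← divergence_gradient (hp.of_le (by norm_cast)), hgrad,
    divergence_sub_apply ((hΔd x).fun_sub (hcd x)) (hUd x), divergence_sub_apply (hΔd x) (hcd x), hdivU, hdivΔ]
  ring


end Poisson

section PoissonIco

variable {u : ℝ → E3 → E3} {p : ℝ → E3 → ℝ} {t₀ T : ℝ}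

/-- **Pressure Poisson equation at the initial time** of a classical solution on `[t₀, T)`:
`Δp(t₀) = −div((u₀·∇)u₀)`. [folklore] -/
theorem laplacian_pressure_eq_Ico (h : IsClassicalNSSolutionOn (Ico t₀ T) 1 0 u p) (hT : t₀ < T)
    {t : ℝ} (ht : t ∈ Ico t₀ T) (x : E3) :
    (Δ (p t)) x = -VectorCalculus.divergence (convect (u t) (u t)) x :=
  laplacian_pressure_eq h (uniqueDiffOn_Ico t₀ T) (Ico_subset_closure_interior hT) ht x


end PoissonIco

/-! ### 2. Open time windows: two-sided jets (the shape of the window bridges PH-W / V-W) -/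

section Window

variable {u : ℝ → E3 → E3} {p : ℝ → E3 → ℝ}

/-- **FIRST JET on an open window**: for a classical solution on an OPEN time set `S` and `t ∈ S`,
`∂ₜF(t, x) = ⟪curl (Δu − (u·∇)u)(t)(x), x − x₀⟫`. [folklore] -/
theorem deriv_threadingFlux_of_isOpen (h : IsClassicalNSSolutionOn S 1 0 u p) (hS : IsOpen S) {t : ℝ}
    (ht : t ∈ S) (x₀ x : E3) :
    deriv (fun s => threadingFlux u x₀ s x) t =
      ⟪curl (fun z => (Δ (u t)) z - convect (u t) (u t) z) x, x - x₀⟫ := by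
  have hcl : S ⊆ closure (interior S) := by rw [hS.interior_eq]; exact subset_closure
  rw [← derivWithin_of_isOpen hS ht, derivWithin_threadingFlux_eq' h hS.uniqueDiffOn hcl ht]

/-- **SECOND JET on an open window**: for a classical solution on an OPEN time set `S`, `t ∈ S`, `u₁ := Δu − (u·∇)u − ∇p`
(at time `t`), `∂ₜ²F(t, x) = ⟪curl (Δu₁ − (u·∇)u₁ − (u₁·∇)u)(t)(x), x − x₀⟫`. [folklore] -/
theorem iteratedDeriv_two_threadingFlux_of_isOpen (h : IsClassicalNSSolutionOn S 1 0 u p) (hS : IsOpen S)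
    {t : ℝ} (ht : t ∈ S) (x₀ x : E3) :
    iteratedDeriv 2 (fun s => threadingFlux u x₀ s x) t =
      ⟪curl (fun z =>
          (Δ (fun y => (Δ (u t)) y - convect (u t) (u t) y - gradient (p t) y)) z
          - (convect (u t) (fun y => (Δ (u t)) y - convect (u t) (u t) y - gradient (p t) y) z
              + convect (fun y => (Δ (u t)) y - convect (u t) (u t) y - gradient (p t) y) (u t) z)) x,
        x - x₀⟫ := by
  have hcl : S ⊆ closure (interior S) := by rw [hS.interior_eq]; exact subset_closure
  rw [← iteratedDerivWithin_of_isOpen hS ht, iteratedDerivWithin_two,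
    derivWithin_derivWithin_threadingFlux h hS.uniqueDiffOn hcl ht, timeDerivWithin_velocity_eq h ht]

end Window

/-! ### 3. The dictionary in the vocabulary of the Defs file -/

section Vocabulary

variable {u : ℝ → E3 → E3} {p : ℝ → E3 → ℝ} {t₀ T : ℝ}

/-- The one-sided first jet at `t₀` of a classical solution on `[t₀, T)` is the formal first jet `fluxJetOne (u t₀) x₀ x`. [folklore] -/
theorem derivWithin_threadingFlux_Ici_eq_fluxJetOne (h : IsClassicalNSSolutionOn (Ico t₀ T) 1 0 u p) (hT : t₀ < T)
    (x₀ x : E3) :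
    derivWithin (fun t => threadingFlux u x₀ t x) (Ici t₀) t₀ = fluxJetOne (u t₀) x₀ x := by
  rw [derivWithin_threadingFlux_Ici h hT]
  rfl

/-- The one-sided second jet at `t₀` of a classical solution on `[t₀, T)` is the formal second jet `fluxJetTwo (u t₀) (p t₀) x₀ x`.
[folklore] -/
theorem iteratedDerivWithin_two_threadingFlux_Ici_eq_fluxJetTwo (h : IsClassicalNSSolutionOn (Ico t₀ T) 1 0 u p)
    (hT : t₀ < T) (x₀ x : E3) :
    iteratedDerivWithin 2 (fun t => threadingFlux u x₀ t x) (Ici t₀) t₀ = fluxJetTwo (u t₀) (p t₀) x₀ x := by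
  rw [iteratedDerivWithin_two_threadingFlux_Ici h hT]
  rfl

/-- On an open window the two-sided second jet at `t ∈ S` is the formal second jet `fluxJetTwo (u t) (p t) x₀ x`. [folklore] -/
theorem iteratedDeriv_two_threadingFlux_eq_fluxJetTwo (h : IsClassicalNSSolutionOn S 1 0 u p) (hS : IsOpen S)
    {t : ℝ} (ht : t ∈ S) (x₀ x : E3) :
    iteratedDeriv 2 (fun s => threadingFlux u x₀ s x) t = fluxJetTwo (u t) (p t) x₀ x := by
  rw [iteratedDeriv_two_threadingFlux_of_isOpen h hS ht]
  rfl

end Vocabulary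

/-! ### 4. The reductions: the bridges follow from their slice forms -/

section Reductions

/-- ★ **BRIDGE V IS L-ONLY**: the ORDER-TWO SLICE LAW (an identity-and-integration statement about the explicit fields
`u₀ = curl curl (H Y y)` and the decaying pressure `p₀`) implies bridge V `VirialHorn.OrderTwoVirialIdentity`.  The classical solution
on `[t₀, T)` supplies at `t₀`: smoothness and incompressibility of `u(t₀) = sepShellL H Y x₀`, smoothness of `p(t₀)`, the pressure
Poisson equation (`laplacian_pressure_eq_Ico`) and the decay hypothesis; the dictionary turns the vanishing one-sided second jet into
`fluxJetTwo u₀ p₀ x₀ ≡ 0`. [folklore] -/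
theorem orderTwoVirialIdentity_of_sliceLaw (hL : OrderTwoSliceLaw) : OrderTwoVirialIdentity := by
  intro l t₀ T u p x₀ Y H hl hT h hp hY hH hu0 hjet ξ
  have ht₀ : t₀ ∈ Ico t₀ T := ⟨le_rfl, hT⟩
  have hsm : ContDiff ℝ ∞ (sepShellL H Y x₀) := by rw [← hu0]; exact h.contDiff_velocity ht₀
  have hdiv : VectorCalculus.IsDivFree (sepShellL H Y x₀) := by rw [← hu0]; exact h.divFree t₀ ht₀
  have hps : ContDiff ℝ ∞ (p t₀) := h.contDiff_pressure ht₀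
  have hpoi : ∀ x : E3, (Δ (p t₀)) x =
      -VectorCalculus.divergence (convect (sepShellL H Y x₀) (sepShellL H Y x₀)) x := by
    intro x
    rw [← hu0]
    exact laplacian_pressure_eq_Ico h hT ht₀ x
  have hj : ∀ x : E3, fluxJetTwo (sepShellL H Y x₀) (p t₀) x₀ x = 0 := by
    intro x
    rw [← hu0, ← iteratedDerivWithin_two_threadingFlux_Ici_eq_fluxJetTwo h hT]
    exact hjet x
  exact hL l x₀ Y H (p t₀) hl hY hH hsm hdiv hps hpoi (hp t₀ ht₀) hj ξ

/-- ★ **BRIDGE PH IS L-ONLY**: the `l = 2` HORN SLICE IDENTITY implies bridge PH `ProfileHorn.HornIdentityTwo`. [folklore] -/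
theorem hornIdentityTwo_of_slice (hL : HornSliceIdentityTwo) : HornIdentityTwo := by
  intro t₀ T u p x₀ Q H hT h hp hQ hH hu0 r hr y hy
  have ht₀ : t₀ ∈ Ico t₀ T := ⟨le_rfl, hT⟩
  have hsm : ContDiff ℝ ∞ (sepShell H Q x₀) := by rw [← hu0]; exact h.contDiff_velocity ht₀
  have hdiv : VectorCalculus.IsDivFree (sepShell H Q x₀) := by rw [← hu0]; exact h.divFree t₀ ht₀
  have hps : ContDiff ℝ ∞ (p t₀) := h.contDiff_pressure ht₀
  have hpoi : ∀ x : E3, (Δ (p t₀)) x =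
      -VectorCalculus.divergence (convect (sepShell H Q x₀) (sepShell H Q x₀)) x := by
    intro x
    rw [← hu0]
    exact laplacian_pressure_eq_Ico h hT ht₀ x
  rw [iteratedDerivWithin_two_threadingFlux_Ici_eq_fluxJetTwo h hT, hu0]
  exact hL Q H x₀ (p t₀) hQ hH hsm hdiv hps hpoi (hp t₀ ht₀) r hr y hy

/-- ★ **LEMMA SEP IS L-ONLY**: the SEPARABLE SLICE ORDER-ONE SILENCE implies `ProfileHorn.SeparableOrderOneSilence`. [folklore] -/
theorem separableOrderOneSilence_of_slice (hL : SeparableSliceOrderOneSilence) : SeparableOrderOneSilence := by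
  intro t₀ T u p x₀ Q H hT h hQ hH hu0 x
  have ht₀ : t₀ ∈ Ico t₀ T := ⟨le_rfl, hT⟩
  have hsm : ContDiff ℝ ∞ (sepShell H Q x₀) := by rw [← hu0]; exact h.contDiff_velocity ht₀
  have hdiv : VectorCalculus.IsDivFree (sepShell H Q x₀) := by rw [← hu0]; exact h.divFree t₀ ht₀
  rw [derivWithin_threadingFlux_Ici_eq_fluxJetOne h hT, hu0]
  exact hL Q H x₀ hQ hH hsm hdiv x

end Reductions

end Summit.NavierStokesRegularity.NavierStokesRegularity.Theorems.UnthreadedRigidity.ThreadingJets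

end
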